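import Literature.AlgebraicGeometry.Frobenioids.Composites
import Mathlib.Algebra.Group.Commute.Units
import HarnessLib

/-!
# Frobenioids I, Proposition 1.10 (Morphisms of Frobenius Type), part (iii)

Mochizuki, *The geometry of Frobenioids I: the general theory*, Kyushu J. Math. **62** (2008)
293–400, §1, Proposition 1.10 (iii) and its proof, kurims text pp. 34–35
[cite: MochizukiFrdI2008, Prop. 1.10(iii)]. Standing data: `C → F_Φ` a Frobenioid (`hF`).

> "(iii) Suppose that `C` is of perfect type. Then the monoids in the image of `Φ` are perfect.
> If, moreover, `C` is of isotropic and Frobenius-normalized type, then the monoids `O^▷(A)` and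
> `O^×(A)` are perfect."

PROVED along the printed proof (p. 35): surjectivity of the `n`-th power maps of `Φ(A)` from the
existence of morphisms of Frobenius type (Def. 1.3 (ii)), the equivalences of Def. 1.3 (iii)(d)
and the definition of a perfect object; for `O^▷(A)`, `O^×(A)`: "we may assume that `A` is
Frobenius-trivial" (Def. 1.3 (i)(a)(b), (iii)(c)), and then perfectness follows from `A` perfect
(applied to the base-identity endomorphisms of Frobenius type `ζ_A(n)`) and Frobenius-normalized.

Renderings (recorded for the referee). "the monoids in the image of `Φ`" ↦ `Φ(A_D)` for every
`A ∈ Ob(C)` (every object of `D` is isomorphic to some `A_D`, Def. 1.3 (i)(a)). Injectivity of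
the power maps of `Φ(A)` holds in any divisorial monoid (sharp, integral, saturated; §0 p. 11 via
`M ↪ M^pf`) and is proved that way. `O^▷(A)` is a submonoid of the (non-commutative) `End A` and
`O^×(A)` a subgroup of `Aut A`; "perfect" for them is stated as the defining property of
`IsPerfect` (§0 p. 11): every `n`-th power map, `n ≥ 1`, is bijective (`O^▷(A)` is commutative in a
Frobenioid, Remark 1.3.1). No statement of the paper is strengthened.
-/

namespace Literature.AlgebraicGeometry.Frobenioids

open CategoryTheory Opposite

universe w v v' u u'

namespace PreFrobenioid

variable {D : Type u} [Category.{v} D] {Φ : Dᵒᵖ ⥤ CommMonCat.{w}}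
  {C : Type u'} [Category.{v'} C] {F : C ⥤ ElemFrobenioid Φ}

/-! ### The divisor monoids are perfect -/

/-- In a divisorial monoid the `n`-th power maps (`n ≥ 1`) are injective (§0 p. 11: `M → M^pf`
is injective for `M` sharp, integral and saturated). [cite: MochizukiFrdI2008, §0 p.11] -/
theorem pow_injective_of_isDivisorial {M : Type w} [CommMonoid M] (hM : IsDivisorial M) {n : ℕ}
    (hn : 0 < n) : Function.Injective fun a : M => a ^ n := fun _ _ hab =>
  of_injective_of_isSharp_isIntegral_isSaturated hM.isSharp hM.isPreDivisorial.isIntegral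
    hM.isPreDivisorial.isSaturated (Perfection.of_eq_of_iff.mpr ⟨⟨n, hn⟩, hab⟩)

/-- **Prop. 1.10 (iii)**, first sentence: if `C` is of perfect type then every `Φ(A_D)` is a
perfect monoid. [cite: MochizukiFrdI2008, Prop. 1.10(iii) p.34] -/
theorem isPerfect_divisorMonoid (hF : IsFrobenioid F) (hperf : IsOfPerfectType F) (A : C) :
    IsPerfect (Φ.obj (op (baseObj F A))) := by
  have hP := hF.isPreFrobenioid
  refine ⟨fun n hn => ⟨pow_injective_of_isDivisorial (hP.isDivisorial (baseObj F A)) hn, ?_⟩⟩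
  intro x
  let nn : ℕ+ := ⟨n, hn⟩
  -- a co-angular pre-step with zero divisor `x`, Frobenius-type morphisms of degree `n` into its
  -- ends, and the descended pre-step provided by perfectness of `A`
  obtain ⟨B, φ, hφ, hφx⟩ := hF.iii_d_under_surj A x
  obtain ⟨h1, h2⟩ := hperf A nn
  obtain ⟨A₁, φ₁, hφ₁, hφ₁d⟩ := h1 A ⟨Iso.refl _⟩
  haveI : IsIso (Base F φ) := hφ.2.2
  obtain ⟨B₂, φ₂, hφ₂, hφ₂d⟩ := h1 B ⟨asIso (Base F φ)⟩
  haveI : IsIso (Base F φ₁) := hφ₁.2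
  haveI : IsIso (Base F φ₂) := hφ₂.2
  obtain ⟨ψ, ⟨-, hsq⟩, -⟩ := h2 φ₁ φ₂ ⟨(asIso (Base F φ₁)).symm⟩
    ⟨asIso (Base F φ) ≪≫ (asIso (Base F φ₂)).symm⟩ hφ₁ hφ₁d hφ₂ hφ₂d φ hφ.2
  have hd := congrArg (Div F) hsq
  rw [div_comp, div_comp, show Div F φ₂ = 1 from hφ₂.1.2, map_one, one_mul, hφ₂d,
    show Div F φ₁ = 1 from hφ₁.1.2, one_pow, mul_one, hφx] at hd
  refine ⟨pull Φ (inv (Base F φ₁)) (Div F ψ), ?_⟩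
  show (pull Φ (inv (Base F φ₁)) (Div F ψ)) ^ (nn : ℕ) = x
  rw [← map_pow, hd, ← pull_comp, IsIso.inv_hom_id, pull_id]

/-! ### `O^▷(A)` and `O^×(A)` for a Frobenius-trivial object -/

/-- An element of `O^▷(A)` is a pre-step (linear with identity base). [cite: MochizukiFrdI2008, Def. 1.2(ii)] -/
theorem isPreStep_coe_endSubmonoid {A : C} (α : endSubmonoid F A) : IsPreStep F (α.1 : A ⟶ A) := by
  refine ⟨α.2.2, ?_⟩
  have h : Base F (α.1 : A ⟶ A) = 𝟙 _ := α.2.1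
  show IsIso (Base F (α.1 : A ⟶ A))
  rw [h]
  infer_instance

/-- For a Frobenius-trivial, Frobenius-normalized, perfect object `A` the `n`-th power maps of
`O^▷(A)` are bijective ("follows immediately from the fact that `A` is perfect [Def. 1.2 (iv),
applied to the base-identity endomorphisms of Frobenius type of the Frobenius-trivial object `A`]
and Frobenius-normalized", p. 35). [cite: MochizukiFrdI2008, Prop. 1.10(iii) p.35] -/
theorem pow_bijective_endSubmonoid_of_isFrobeniusTrivial (hF : IsFrobenioid F) {A : C}
    (htriv : IsFrobeniusTrivial F A) (hnorm : IsFrobeniusNormalized F A) (hperf : IsPerfectObj F A)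
    {n : ℕ} (hn : 0 < n) : Function.Bijective fun a : endSubmonoid F A => a ^ n := by
  have hP := hF.isPreFrobenioid
  have hC := hP.isTotallyEpimorphic
  obtain ⟨ζ, hζ⟩ := htriv
  obtain ⟨hζd, hζb, hζf⟩ := hζ ⟨n, hn⟩
  haveI := hC.epi (ζ ⟨n, hn⟩ : A ⟶ A)
  -- Frobenius-normalized: `f ≫ α^n = α ≫ f` for `α ∈ O^▷(A)` and `f = ζ(n)`
  have hcomm : ∀ α : endSubmonoid F A,
      (ζ ⟨n, hn⟩ : A ⟶ A) ≫ ((α ^ n).1 : A ⟶ A) = (α.1 : A ⟶ A) ≫ (ζ ⟨n, hn⟩ : A ⟶ A) := by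
    intro α
    have := hnorm (ζ ⟨n, hn⟩) hζb α.1 α.2
    rw [hζd] at this
    exact this
  obtain ⟨-, h2⟩ := hperf ⟨n, hn⟩
  have huniq := h2 (ζ ⟨n, hn⟩) (ζ ⟨n, hn⟩) ⟨Iso.refl _⟩ ⟨Iso.refl _⟩ hζf hζd hζf hζd
  constructor
  · intro α β hαβ
    have hαβ' : (α ^ n : endSubmonoid F A) = β ^ n := hαβ
    obtain ⟨ψ, -, hψu⟩ := huniq _ (isPreStep_coe_endSubmonoid (α ^ n))
    have hα : (α.1 : A ⟶ A) = ψ := hψu _ ⟨isPreStep_coe_endSubmonoid α, (hcomm α).symm⟩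
    have hβ : (β.1 : A ⟶ A) = ψ :=
      hψu _ ⟨isPreStep_coe_endSubmonoid β, by rw [hαβ']; exact (hcomm β).symm⟩
    exact Subtype.ext (hα.trans hβ.symm)
  · intro α'
    obtain ⟨ψ, ⟨hψ, hsq⟩, -⟩ := huniq _ (isPreStep_coe_endSubmonoid α')
    -- `ψ` is a base-identity linear endomorphism
    have hψb : IsBaseIdentity F ψ := by
      have h := congrArg (Base F) hsq
      rw [base_comp, base_comp, show Base F (ζ ⟨n, hn⟩ : A ⟶ A) = 𝟙 _ from hζb, Category.comp_id,
        Category.id_comp, show Base F (α'.1 : A ⟶ A) = 𝟙 _ from α'.2.1] at h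
      exact h
    let ψ' : endSubmonoid F A := ⟨ψ, hψb, hψ.1⟩
    refine ⟨ψ', Subtype.ext ?_⟩
    -- `f ≫ ψ^n = ψ ≫ f = f ≫ α'`, and `f` is an epimorphism
    have := hcomm ψ'
    rw [show (ψ'.1 : A ⟶ A) = ψ from rfl, hsq] at this
    exact (cancel_epi (ζ ⟨n, hn⟩ : A ⟶ A)).mp this

/-- Bijectivity of the `n`-th power maps passes from `O^▷(A)` to `O^×(A)`: an endomorphism whose
`n`-th power is invertible is invertible. [cite: MochizukiFrdI2008, Prop. 1.10(iii) p.35] -/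
theorem pow_bijective_unitsSubgroup_of_endSubmonoid {A : C} {n : ℕ} (hn : 0 < n)
    (h : Function.Bijective fun a : endSubmonoid F A => a ^ n) :
    Function.Bijective fun a : unitsSubgroup F A => a ^ n := by
  -- the injective homomorphism `O^×(A) → O^▷(A)`
  let ι : unitsSubgroup F A →* endSubmonoid F A :=
    { toFun := fun u => ⟨u.1.hom, u.2⟩
      map_one' := rfl
      map_mul' := fun _ _ => rfl }
  have hι : Function.Injective ι := by
    intro u v huv
    exact Subtype.ext (Iso.ext (congrArg Subtype.val huv))
  constructor
  · intro u v huv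
    apply hι
    apply h.1
    show ι u ^ n = ι v ^ n
    rw [← map_pow, ← map_pow]
    exact congrArg ι huv
  · intro u
    obtain ⟨ψ, hψ⟩ := h.2 (ι u)
    have hψn : (ψ ^ n : endSubmonoid F A) = ι u := hψ
    -- `ψ^n = u` is a unit of `End A`, hence so is `ψ`
    have hunit : IsUnit (ψ.1 : End A) := by
      rw [← isUnit_pow_iff hn.ne']
      have : (ψ ^ n).1 = (ψ.1) ^ n := rfl
      rw [← this, hψn]
      exact ⟨(Aut.unitsEndEquivAut A).symm u.1, rfl⟩
    obtain ⟨w, hw⟩ := hunit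
    let v : Aut A := Aut.unitsEndEquivAut A w
    have hv : v.hom = ψ.1 := hw
    have hvmem : v ∈ unitsSubgroup F A := by
      show IsBaseIdentity F v.hom ∧ IsLinear F v.hom
      rw [hv]
      exact ψ.2
    refine ⟨⟨v, hvmem⟩, ?_⟩
    apply hι
    have h1 : ι ⟨v, hvmem⟩ = ψ := Subtype.ext hv
    show ι (⟨v, hvmem⟩ ^ n) = ι u
    rw [map_pow, h1, hψn]

/-! ### Reduction to Frobenius-trivial objects -/

/-- "By the existence of Frobenius-trivial objects [Def. 1.3 (i)(a), (b); the isomorphism of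
Def. 1.3 (iii)(c)], we may assume that `A` is Frobenius-trivial": in a Frobenioid of isotropic
type every `O^▷(A)` is isomorphic to `O^▷(A₀)` for some Frobenius-trivial `A₀`.
[cite: MochizukiFrdI2008, Prop. 1.10(iii) p.35] -/
theorem exists_endSubmonoid_mulEquiv_of_isFrobeniusTrivial (hF : IsFrobenioid F)
    (histr : IsOfIsotropicType F) (A : C) :
    ∃ (A₀ : C) (_ : endSubmonoid F A ≃* endSubmonoid F A₀), IsFrobeniusTrivial F A₀ := by
  obtain ⟨A₀, hA₀, ⟨i⟩⟩ := hF.i_a (baseObj F A)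
  obtain ⟨X, φ, ψ, hφ, hψ, -⟩ := hF.i_b A₀ A i
  have hco : ∀ {Y : C} (g : X ⟶ Y), IsCoAngular F g :=
    fun g => isCoAngular_of_isIsotropic_codomains F g (fun Y _ => histr Y)
  obtain ⟨e₁, -⟩ := hF.iii_c φ ⟨hco φ, hφ⟩
  obtain ⟨e₂, -⟩ := hF.iii_c ψ ⟨hco ψ, hψ⟩
  exact ⟨A₀, e₂.symm.trans e₁, hA₀⟩

/-! ### Proposition 1.10 (iii), second sentence -/

/-- **Prop. 1.10 (iii)**, `O^▷(A)`: in a Frobenioid of perfect, isotropic and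
Frobenius-normalized type the `n`-th power maps (`n ≥ 1`) of every `O^▷(A)` are bijective, i.e.
`O^▷(A)` is perfect. [cite: MochizukiFrdI2008, Prop. 1.10(iii) p.34] -/
theorem pow_bijective_endSubmonoid (hF : IsFrobenioid F) (hperf : IsOfPerfectType F)
    (histr : IsOfIsotropicType F) (hnorm : IsOfType (IsFrobeniusNormalized F)) (A : C) {n : ℕ}
    (hn : 0 < n) : Function.Bijective fun a : endSubmonoid F A => a ^ n := by
  obtain ⟨A₀, e, hA₀⟩ := exists_endSubmonoid_mulEquiv_of_isFrobeniusTrivial hF histr A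
  have h₀ := pow_bijective_endSubmonoid_of_isFrobeniusTrivial hF hA₀ (hnorm A₀) (hperf A₀) hn
  have hcomm : (fun a : endSubmonoid F A => a ^ n) = e.symm ∘ (fun a => a ^ n) ∘ e := by
    ext a
    simp
  rw [hcomm]
  exact e.symm.bijective.comp (h₀.comp e.bijective)

/-- **Prop. 1.10 (iii)**, `O^×(A)`: under the same hypotheses the `n`-th power maps of every
`O^×(A)` are bijective, i.e. `O^×(A)` is perfect. [cite: MochizukiFrdI2008, Prop. 1.10(iii) p.34] -/
theorem pow_bijective_unitsSubgroup (hF : IsFrobenioid F) (hperf : IsOfPerfectType F)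
    (histr : IsOfIsotropicType F) (hnorm : IsOfType (IsFrobeniusNormalized F)) (A : C) {n : ℕ}
    (hn : 0 < n) : Function.Bijective fun a : unitsSubgroup F A => a ^ n :=
  pow_bijective_unitsSubgroup_of_endSubmonoid hn (pow_bijective_endSubmonoid hF hperf histr hnorm A hn)

end PreFrobenioid

end Literature.AlgebraicGeometry.Frobenioids
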